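import Summits.AtomisticToContinuum.BoseEinsteinCondensation.Theses.BECRieszReverseHolder
import Summits.AtomisticToContinuum.BoseEinsteinCondensation.Theorems.BECRieszReverseHolderCoarseGrainedReverseHolderReduction
import Summits.AtomisticToContinuum.BoseEinsteinCondensation.Theorems.BECRieszReverseHolderCoarseGrainedReverseHolderGroundStateEquivalence
import Summits.AtomisticToContinuum.BoseEinsteinCondensation.Theorems.BECRieszReverseHolderCoarseGrainedReverseHolderShadowVarianceEquivalence
import Summits.AtomisticToContinuum.BoseEinsteinCondensation.Theorems.BECRieszReverseHolderCoarseGrainedReverseHolderSufficientConditions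
import Summits.AtomisticToContinuum.BoseEinsteinCondensation.Theorems.BECRieszReverseHolderCoarseGrainedReverseHolderConsequences
import Summits.AtomisticToContinuum.BoseEinsteinCondensation.Theorems.BECRieszReverseHolderCoarseGrainedReverseHolderEntropyConsequences
import Literature.MathematicalPhysics.QuantumManyBody.GroundState
import HarnessLib.Audit

/-!
# Skeleton `registered` for crux `BECRieszReverseHolder.CoarseGrainedReverseHolder`
(item stmt-AtomisticToContinuum-12840, rank 2, route route-AtomisticToContinuum-BECRieszReverseHolder;
line lead prover-line-stmt-AtomisticToContinuum-12840-c7-0, continuation of leads …-12840-0 / …-c1-0 /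
…-c2-0 / …-c3-0 / …-c4-0 / …-c5-0 / …-c6-0, 2026-08-17)

Crux (fixed, by name): for admissible `v`, small `ρ`, every resolution `ℓ > 0` there is `C` with,
eventually in `N = n+1`, some `δ > 0` such that EVERY non-negative `δ`-near-minimiser `Ψ` of the Dirichlet
energy in the box of side `L = (N/ρ)^{1/3}` has coarse-grained reverse-Hölder functional
`F_{n,ℓ}(Ψ) := m³ ∫dX̂ Σ_Q (∫_Q Ψ(y,X̂)² dy)² / ∫ Ψ(y,X̂)² dy ≤ C` (`m = ⌊L/ℓ⌋`, cubes `Q` of side `L/m`).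

STATE OF THE LINE (leads c0–c7; everything below the stub is LANDED `--supports stmt-AtomisticToContinuum-12840`):
* crux ⇔ GS-bound (the same bound on non-negative GROUND STATES; p149554/p150465) ⇔ the shadow-variance
  form S3′ (p162828); crux ⇒ `PositiveZeroMode` (p152916); resolution-free entry points (slice `L⁴/L²`,
  maximal slice ⇒ crux; p165671); the classical Riesz-2 engine and the shadow-state certification
  (p156567 … p160959);
* lead c7 (this skeleton's wave, p172769 p172997 p173174 p173344, composed in p173655
  `…CoarseGrainedReverseHolderEntropyConsequences.lean`): crux ⇒ `BECCellInformation.CondEntropyBound`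
  (item 13438, the TARGET of the sibling conditional-entropy route, through its proved `TwoScaleReduction` +
  `EnergyPerParticleBound`) ⇒ `BECCellInformation.CellInformationBound` (item 13439, its open crux); and the
  crux is its own small-scale germ (`coarseGrainedReverseHolder_of_smallScales`: the bound at resolutions
  `ℓ ≤ ℓ₀` gives it at every `ℓ`, coarser partitions being dominated by finer ones up to the factor `216`).
  So 12840 sits ABOVE 13439/13438 in the lattice of open positivity leaves: the Shannon (mutual-information)
  leaf is the weaker statement, and its refutation would refute this crux.

The ONE open stub is GS-bound itself = informal item stmt-AtomisticToContinuum-12602 typed; it is of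
open-problem strength (TD-limit BEC, LSSY2005 Ch. 5). It is stated `let`-FREE (the binders
`let L := …; let m := …` of the crux substituted; definitionally equal): the ledger's skeleton registration
cuts a stub signature at the first `:=`, so the c6 registration read `… → let L`.

Disproof used: none exists for this crux (`ledger crux ls`: no Disproof.lean, no Negative/, 2026-08-17T19:30Z).
-/

noncomputable section

open MeasureTheory Filter Matrix
open scoped ENNReal NNReal BigOperators

namespace Summit.AtomisticToContinuum.BoseEinsteinCondensation.Cruxes.CoarseGrainedReverseHolder.Registered

open Literature.MathematicalPhysics.QuantumManyBody
open Summit.AtomisticToContinuum.BoseEinsteinCondensation.Theses.BECRieszReverseHolder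
open Summit.AtomisticToContinuum.BoseEinsteinCondensation.Theorems.CoarseGrainedReverseHolder

/-! ## Stub (`sorry` only here) -/

/-- **GS-bound — the uniform coarse reverse-Hölder bound on non-negative GROUND STATES (the open content
of the crux, crux-EQUIVALENT by `coarseGrainedReverseHolder_iff_groundStates`, HARDEST and only stub;
`let`-free form).** For admissible `v`, small `ρ`, every `ℓ > 0` there is `C` such that eventually in `n`,
every non-negative ground state `Φ` (`BoseGas.IsGroundState`, `Φ = ‖Φ‖` pointwise) of `n+1` bosons in the
Dirichlet box of side `L = sideLength ρ (n+1) = ((n+1)/ρ)^{1/3}` has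
`F_{n,ℓ}(Φ) = E_μ̂[m³ Σ_Q p_Q²] ≤ C`, `m = ⌊L/ℓ⌋₊`, cubes `Q_k = ∏ᵢ [kᵢ L/m, (kᵢ+1) L/m)` (`μ̂ = M dX̂` the
`(N−1)`-marginal, `p_Q = ∫_Q Φ(·,X̂)²/M(X̂)`). Heuristics: `C = (3/2)³` at `v = 0`, `C ≈ 1 + O(√(ρa³))` in
Bogoliubov/Jastrow theory; certified for the shadow state (p160959); entry points p165671; implies
`PositiveZeroMode` (p152916) and `BECCellInformation.CondEntropyBound` (p173655): open-problem strength
(LSSY2005 Ch. 5). -/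
theorem stub_groundStateBound :
    ∀ v : ℝ → ENNReal, BoseGas.IsRepulsiveFiniteRange v →
      ∃ ρ₀ : ℝ, 0 < ρ₀ ∧ ∀ ρ : ℝ, 0 < ρ → ρ < ρ₀ → ∀ ℓ : ℝ, 0 < ℓ → ∃ C : ℝ,
      ∀ᶠ n : ℕ in Filter.atTop,
        ∀ Φ : BoseGas.Config (n + 1) → ℂ,
          BoseGas.IsGroundState v (BoseGas.sideLength ρ (n + 1)) Φ → (∀ X, Φ X = (‖Φ X‖ : ℂ)) →
          (⌊BoseGas.sideLength ρ (n + 1) / ℓ⌋₊ : ENNReal) ^ 3 *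
              ∫⁻ X : Fin n → EuclideanSpace ℝ (Fin 3),
                ((∑ k : Fin 3 → Fin ⌊BoseGas.sideLength ρ (n + 1) / ℓ⌋₊,
                    (∫⁻ y in {y : EuclideanSpace ℝ (Fin 3) | ∀ i, y i ∈
                        Set.Ico ((k i : ℝ) * (BoseGas.sideLength ρ (n + 1) /
                            ⌊BoseGas.sideLength ρ (n + 1) / ℓ⌋₊))
                          (((k i : ℝ) + 1) * (BoseGas.sideLength ρ (n + 1) /
                            ⌊BoseGas.sideLength ρ (n + 1) / ℓ⌋₊))},
                      (‖Φ (Matrix.vecCons y X)‖₊ : ENNReal) ^ 2) ^ 2) /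
                  (∫⁻ y, (‖Φ (Matrix.vecCons y X)‖₊ : ENNReal) ^ 2))
            ≤ ENNReal.ofReal C := by
  sorry

/-! ## Composition (sorry-free apart from the stub; concludes the crux BY NAME) -/

/-- **Registered skeleton theorem** — `CoarseGrainedReverseHolder` from the single open stub GS-bound
through the LANDED first layer `coarseGrainedReverseHolder_of_groundStates` (compactness S2 + Lipschitz
S1 + `GroundStateEnergyFinite`). -/
theorem CoarseGrainedReverseHolder_of : CoarseGrainedReverseHolder :=
  coarseGrainedReverseHolder_of_groundStates stub_groundStateBound

/-! ## Certificates (sorry-free; what the stub is, exactly, and what it is worth) -/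

/-- **The stub is the crux**: GS-bound (`let`-free) ↔ `CoarseGrainedReverseHolder` (landed p149554/p150465). -/
theorem gsBound_iff_crux :
    (∀ v : ℝ → ENNReal, BoseGas.IsRepulsiveFiniteRange v →
      ∃ ρ₀ : ℝ, 0 < ρ₀ ∧ ∀ ρ : ℝ, 0 < ρ → ρ < ρ₀ → ∀ ℓ : ℝ, 0 < ℓ → ∃ C : ℝ,
      ∀ᶠ n : ℕ in Filter.atTop,
        ∀ Φ : BoseGas.Config (n + 1) → ℂ,
          BoseGas.IsGroundState v (BoseGas.sideLength ρ (n + 1)) Φ → (∀ X, Φ X = (‖Φ X‖ : ℂ)) →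
          (⌊BoseGas.sideLength ρ (n + 1) / ℓ⌋₊ : ENNReal) ^ 3 *
              ∫⁻ X : Fin n → EuclideanSpace ℝ (Fin 3),
                ((∑ k : Fin 3 → Fin ⌊BoseGas.sideLength ρ (n + 1) / ℓ⌋₊,
                    (∫⁻ y in {y : EuclideanSpace ℝ (Fin 3) | ∀ i, y i ∈
                        Set.Ico ((k i : ℝ) * (BoseGas.sideLength ρ (n + 1) /
                            ⌊BoseGas.sideLength ρ (n + 1) / ℓ⌋₊))
                          (((k i : ℝ) + 1) * (BoseGas.sideLength ρ (n + 1) /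
                            ⌊BoseGas.sideLength ρ (n + 1) / ℓ⌋₊))},
                      (‖Φ (Matrix.vecCons y X)‖₊ : ENNReal) ^ 2) ^ 2) /
                  (∫⁻ y, (‖Φ (Matrix.vecCons y X)‖₊ : ENNReal) ^ 2))
            ≤ ENNReal.ofReal C) ↔ CoarseGrainedReverseHolder :=
  coarseGrainedReverseHolder_iff_groundStates.symm

/-- **What the stub is worth, I** (landed p152916): the stub alone gives flat-mode BEC of non-negative
near-minimisers in the thermodynamic limit (`PositiveZeroMode`, the route target 12839). -/
theorem positiveZeroMode_of_stub : PositiveZeroMode :=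
  positiveZeroMode_of_groundStateBound stub_groundStateBound

/-- **What the stub is worth, II** (landed p173655): the stub alone gives the TARGET of the sibling
route `BECCellInformation` — the bounded conditional entropy deficit `E_Y KL(p(·|Y) ‖ u_Λ) ≤ C` of one
boson given all the others (item 13438). -/
theorem condEntropyBound_of_stub :
    Summit.AtomisticToContinuum.BoseEinsteinCondensation.Theses.BECCellInformation.CondEntropyBound :=
  condEntropyBound_of_coarseGrainedReverseHolder CoarseGrainedReverseHolder_of

/-- **What the stub is worth, III** (landed p173655): the stub alone gives the open crux of the sibling
route `BECCellInformation` — the coarse mutual-information bound `I(cell_l(x₁); (x₂,…,x_N)) ≤ C`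
(item 13439). -/
theorem cellInformationBound_of_stub :
    Summit.AtomisticToContinuum.BoseEinsteinCondensation.Theses.BECCellInformation.CellInformationBound :=
  cellInformationBound_of_coarseGrainedReverseHolder CoarseGrainedReverseHolder_of

end Summit.AtomisticToContinuum.BoseEinsteinCondensation.Cruxes.CoarseGrainedReverseHolder.Registered

end
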